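import Literature.AlgebraicGeometry.Motives.TateConjectureDominatedVarieties
import Literature.AlgebraicGeometry.Motives.PushforwardKunnethFormula
import Literature.AlgebraicGeometry.Motives.FrobeniusTrace
import HarnessLib

/-!
# Push-forward is Galois equivariant up to the Tate twist; Tate classes under `f₊`

For a Weil cohomology theory with Galois action `E : GaloisWeilCohomology k K χ` (the tree's
hypothesis structure: `ρ X i : Γ_k → GL(Hⁱ(X))`, pull-backs and cup products equivariant, the
trace invariant on `H²ⁿ(X)(n)`, Tate 1994 §1) and a morphism `f : V ⟶ U` of smooth projective
varieties (`dim V = N`, `dim U = M`), the push-forward `f₊ : Hᵉ(V) → Hᵈ(U)` — the Poincaré dual of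
`f*` (Kahn 2020 §3.5.1, where it is written with its twist,
`f_* : Hⁱ(X) → H^{i+2n-2m}(Y)(n - m)`) — satisfies

* **`f₊ ∘ g = χ(g)^{M-N} · g ∘ f₊`** (`pushforward_ρ`), i.e. **`f₊ : Hᵉ(V)(j) → Hᵈ(U)(j')` is
  `Γ_k`-equivariant for `j + M = j' + N`** (`pushforward_ρTwist`): the twist by
  `dim U - dim V` of Kahn 2020 §3.5.1 / Tate 1994 §1;
* hence `f₊` maps Galois invariants of `Hᵉ(V)(j)` to Galois invariants of `Hᵈ(U)(j')` and
  **Tate classes to Tate classes**, `f₊ Tateᵃ(V) ⊆ Tateᵇ(U)` for `a + M = b + N`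
  (`pushforward_mem_invariants`, `pushforward_mem_tateClasses`), the Galois side of
  "algebraic correspondences preserve algebraic classes" (`pushforward_mem_algebraicClasses`);
* cup products of invariant / Tate classes are invariant / Tate (`cup_mem_invariants`,
  `cup_mem_tateClasses`: twists add, open subgroups intersect);
* for `U` **dominated** by `V` (`f₊ ζ ≠ 0`, `ζ ∈ Aʳ(V)_ℚ`, `N = M + r`, Kleiman 1968 Prop. 1.2.4):
  **`Tateᵇ(U) = f₊ Tate^{b+r}(V)`** and `(H^{2b}(U)(b))^Γ = f₊ (H^{2(b+r)}(V)(b+r))^Γ`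
  (`map_pushforward_tateClasses_eq`, `map_pushforward_invariants_eq`; the section
  `x = f₊ (q⁻¹ · (f* x ∪ ζ))`), so the inclusion `Tate ⊆ algebraic` descends from `V`
  (codimension `b + r`) to `U` (codimension `b`) (`tateClasses_le_algebraicClasses_of_pushforward_ne_zero`);
* over a finite field, **`F ∘ f₊ = χ(F)^{N-M} · f₊ ∘ F`** for the geometric Frobenius
  `F = geomFrob k` (`frobAction_pushforward`; with `χ(F) = q⁻¹` this is the classical
  `F f₊ = q^{M-N} f₊ F`, Deligne 1974 (1.5)).

Theorems only (no definition, no named fact, no instance); all statements are formal consequences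
of the fields `pullback_ρ`, `cup_ρ`, `trace_ρ`, `cycleClass_ρ` of `GaloisWeilCohomology` and of
the push-forward API (`trace_cup_pushforward`, `pdEquiv`, `exists_pushforward_eq_ratCast_smul_one`,
`eq_pushforward_of_pushforward_eq_smul_one`, `pullback_mem_tateClasses`).

## References

* [Tate1994] J. Tate, *Conjectures on algebraic cycles in ℓ-adic cohomology*, in: Motives
  (Seattle 1991), Proc. Sympos. Pure Math. 55.1 (1994), 71–83, §1.
* [Kahn2020] B. Kahn, *Zeta and L-functions of varieties and motives*, LMS Lecture Note Ser. 462
  (2020), §3.5.1 (direct image with its Tate twist, projection formula), §6.9 Lemma 6.30 (2).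
* [Kleiman1968AlgebraicCycles] S. Kleiman, *Algebraic cycles and the Weil conjectures*, in: Dix
  exposés sur la cohomologie des schémas (1968), §1.2 Prop. 1.2.4, §1.3.
* [Deligne1974] P. Deligne, *La conjecture de Weil. I*, Publ. Math. IHÉS 43 (1974), (1.5).
-/

universe u v

open CategoryTheory AlgebraicGeometry MonoidalCategory CartesianMonoidalCategory

noncomputable section

namespace Literature.AlgebraicGeometry.Motives

namespace GaloisWeilCohomology

variable {k : Type u} [Field k] {K : Type v} [Field K] [CharZero K]
  {χ : Field.absoluteGaloisGroup k →* Kˣ} (E : GaloisWeilCohomology k K χ)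
variable {N M n r : ℕ} {V U X : SchemeOver k}

/-! ## The trace and the Galois action -/

/-- **`tr_X (g x) = χ(g)^{-n} tr_X x`** on `H²ⁿ(X)`, `n = dim X`: the trace is invariant on the
twist `H²ⁿ(X)(n)` (axiom `trace_ρ`, Tate 1994 §1). [cite: Tate1994, §1] -/
theorem trace_ρ_eq (hX : IsSmoothProjective n X) (g : Field.absoluteGaloisGroup k)
    (x : E.obj X (2 * n)) :
    E.trace X n (E.ρ X (2 * n) g x) = ((χ g : K) ^ (n : ℤ))⁻¹ * E.trace X n x := by
  have hχ : ((χ g : K) ^ (n : ℤ)) ≠ 0 := zpow_ne_zero _ (Units.ne_zero _)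
  rw [← E.trace_ρ hX g x, map_smul, smul_eq_mul, ← mul_assoc, inv_mul_cancel₀ hχ, one_mul]

/-- `g (g⁻¹ x) = x` for the Galois action on `Hⁱ(X)`. [cite: Tate1994, §1] -/
private theorem ρ_apply_ρ_inv (X : SchemeOver k) (i : ℕ) (g : Field.absoluteGaloisGroup k)
    (x : E.obj X i) : E.ρ X i g (E.ρ X i g⁻¹ x) = x := by
  rw [← Module.End.mul_apply, ← map_mul, mul_inv_cancel, map_one, Module.End.one_apply]

/-! ## `f₊` is equivariant up to the twist `χ^{M-N}` -/

/-- **`f₊ (g α) = χ(g)^{M-N} · g (f₊ α)`** for `f : V ⟶ U` (`dim V = N`, `dim U = M`),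
`α ∈ Hᵉ(V)`, `g ∈ Γ_k`: push-forward is Galois equivariant up to the twist by `dim U - dim V`
(Kahn 2020 §3.5.1, `f_* : Hⁱ(X) → H^{i+2n-2m}(Y)(n-m)`; Tate 1994 §1). Proof: pair with `g β`,
`β ∈ H^c(U)`; `tr_U (f₊(gα) ∪ gβ) = tr_V (gα ∪ f* gβ) = tr_V (g(α ∪ f*β)) = χ(g)^{-N} tr_V (α ∪ f*β)`
(`pullback_ρ`, `cup_ρ`, `trace_ρ`) while `tr_U (g f₊α ∪ gβ) = χ(g)^{-M} tr_U (f₊ α ∪ β)`.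
[cite: Kahn2020, §3.5.1] [cite: Tate1994, §1] -/
theorem pushforward_ρ (hV : IsSmoothProjective N V) (hU : IsSmoothProjective M U) (f : V ⟶ U)
    {e d c : ℕ} (he : e + c = 2 * N) (hd : d + c = 2 * M) (g : Field.absoluteGaloisGroup k)
    (α : E.obj V e) :
    E.pushforward (N := N) hU f he hd (E.ρ V e g α) =
      ((χ g : K) ^ ((M : ℤ) - N)) • E.ρ U d g (E.pushforward (N := N) hU f he hd α) := by
  have hχ : (χ g : K) ≠ 0 := Units.ne_zero _
  refine (E.pdEquiv hU hd).injective (LinearMap.ext fun β ↦ ?_)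
  obtain ⟨β, rfl⟩ : ∃ β', β = E.ρ U c g β' := ⟨E.ρ U c g⁻¹ β, (E.ρ_apply_ρ_inv U c g β).symm⟩
  have hρ : E.pullback f c (E.ρ U c g β) = E.ρ V c g (E.pullback f c β) := by
    simpa only [LinearMap.comp_apply] using (LinearMap.congr_fun (E.pullback_ρ hV hU f c g) β).symm
  rw [E.pdEquiv_apply, E.pdEquiv_apply, E.trace_cup_pushforward, hρ, ← E.cup_ρ hV he g,
    E.trace_ρ_eq hV, LinearMap.map_smul₂, map_smul, smul_eq_mul, ← E.cup_ρ hU hd g,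
    E.trace_ρ_eq hU, E.trace_cup_pushforward, ← mul_assoc, zpow_sub₀ hχ, div_mul_eq_mul_div,
    mul_inv_cancel₀ (zpow_ne_zero _ hχ), one_div]

/-- **`f₊ : Hᵉ(V)(j) → Hᵈ(U)(j')` is `Γ_k`-equivariant for `j + dim U = j' + dim V`**
(Kahn 2020 §3.5.1: the direct image lands in the twist by `dim U - dim V`; Tate 1994 §1).
[cite: Kahn2020, §3.5.1] [cite: Tate1994, §1] -/
theorem pushforward_ρTwist (hV : IsSmoothProjective N V) (hU : IsSmoothProjective M U)
    (f : V ⟶ U) {e d c : ℕ} (he : e + c = 2 * N) (hd : d + c = 2 * M) {j j' : ℤ}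
    (hj : j + M = j' + N) (g : Field.absoluteGaloisGroup k) (α : E.obj V e) :
    E.pushforward (N := N) hU f he hd (E.ρTwist V e j g α) =
      E.ρTwist U d j' g (E.pushforward (N := N) hU f he hd α) := by
  have hχ : (χ g : K) ≠ 0 := Units.ne_zero _
  rw [E.ρTwist_apply, E.ρTwist_apply, map_smul, E.pushforward_ρ hV hU f he hd g α, smul_smul,
    ← zpow_add₀ hχ, show j + ((M : ℤ) - N) = j' by omega]

/-- **`f₊` maps Galois invariants of `Hᵉ(V)(j)` to Galois invariants of `Hᵈ(U)(j')`**,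
`j + dim U = j' + dim V` (Tate 1994 §1). [cite: Tate1994, §1] -/
theorem pushforward_mem_invariants (hV : IsSmoothProjective N V) (hU : IsSmoothProjective M U)
    (f : V ⟶ U) {e d c : ℕ} (he : e + c = 2 * N) (hd : d + c = 2 * M) {j j' : ℤ}
    (hj : j + M = j' + N) {x : E.obj V e} (hx : x ∈ (E.ρTwist V e j).invariants) :
    E.pushforward (N := N) hU f he hd x ∈ (E.ρTwist U d j').invariants := fun g ↦ by
  rw [← E.pushforward_ρTwist hV hU f he hd hj g x, hx g]

/-- **`f₊` maps Tate classes to Tate classes: `f₊ Tateᵃ(V) ⊆ Tateᵇ(U)` for `a + dim U = b + dim V`**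
(classes fixed by an open subgroup of `Γ_k` in `H²ᵃ(V)(a)`, resp. `H²ᵇ(U)(b)`; Tate 1994 §1).
Degrees: `2a + c = 2N`, `2b + c = 2M`. [cite: Tate1994, §1] -/
theorem pushforward_mem_tateClasses (hV : IsSmoothProjective N V) (hU : IsSmoothProjective M U)
    (f : V ⟶ U) {a b c : ℕ} (hab : a + M = b + N) (he : 2 * a + c = 2 * N)
    (hd : 2 * b + c = 2 * M) {x : E.obj V (2 * a)} (hx : x ∈ E.tateClasses V a) :
    E.pushforward (N := N) hU f he hd x ∈ E.tateClasses U b := by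
  simp only [GaloisWeilCohomology.tateClasses, mem_smoothInvariants_iff] at hx ⊢
  obtain ⟨O, hO⟩ := hx
  exact ⟨O, fun g hg ↦ by
    rw [← E.pushforward_ρTwist hV hU f he hd (j := a) (j' := b) (by omega) g x, hO g hg]⟩

/-! ## Cup products of invariant and of Tate classes -/

/-- **Cup products of Galois invariants are Galois invariants**: for `x ∈ (Hⁱ(X)(a))^Γ`,
`y ∈ (Hʲ(X)(b))^Γ`, `x ∪ y ∈ (H^{i+j}(X)(a + b))^Γ` (`cup_ρ`: `g(x ∪ y) = gx ∪ gy`, and the twists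
multiply; Tate 1994 §1). [cite: Tate1994, §1] -/
theorem cup_mem_invariants (hX : IsSmoothProjective n X) {i j m : ℕ} (h : i + j = m) {a b c : ℤ}
    (habc : a + b = c) {x : E.obj X i} {y : E.obj X j} (hx : x ∈ (E.ρTwist X i a).invariants)
    (hy : y ∈ (E.ρTwist X j b).invariants) : E.cup h x y ∈ (E.ρTwist X m c).invariants := by
  subst habc
  intro g
  have hχ : (χ g : K) ≠ 0 := Units.ne_zero _
  have hx' := hx g
  have hy' := hy g
  rw [E.ρTwist_apply] at hx' hy' ⊢
  rw [E.cup_ρ hX h g]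
  conv_rhs => rw [← hx', ← hy']
  rw [LinearMap.map_smul₂, map_smul, smul_smul, zpow_add₀ hχ]

/-- **Cup products of Tate classes are Tate classes**: `Tateᵖ(X) ∪ Tate^q(X) ⊆ Tate^{p+q}(X)`
(a class fixed by the open subgroup `O₁` times a class fixed by `O₂` is fixed by `O₁ ∩ O₂`;
Tate 1994 §1). [cite: Tate1994, §1] -/
theorem cup_mem_tateClasses (hX : IsSmoothProjective n X) {p q s : ℕ} (hpq : p + q = s)
    (h : 2 * p + 2 * q = 2 * s) {x : E.obj X (2 * p)} {y : E.obj X (2 * q)}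
    (hx : x ∈ E.tateClasses X p) (hy : y ∈ E.tateClasses X q) :
    E.cup h x y ∈ E.tateClasses X s := by
  simp only [GaloisWeilCohomology.tateClasses, mem_smoothInvariants_iff] at hx hy ⊢
  obtain ⟨O₁, h₁⟩ := hx
  obtain ⟨O₂, h₂⟩ := hy
  refine ⟨O₁ ⊓ O₂, fun g hg ↦ ?_⟩
  have hχ : (χ g : K) ≠ 0 := Units.ne_zero _
  obtain ⟨hg₁, hg₂⟩ := OpenSubgroup.mem_inf.mp hg
  have hx' := h₁ g hg₁
  have hy' := h₂ g hg₂
  rw [E.ρTwist_apply] at hx' hy' ⊢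
  rw [E.cup_ρ hX h g]
  conv_rhs => rw [← hx', ← hy']
  rw [LinearMap.map_smul₂, map_smul, smul_smul, ← zpow_add₀ hχ, show (p : ℤ) + q = s by omega]

/-- Rational algebraic classes are Tate classes (`Aʳ(X)_ℚ ⊆ K · Aʳ(X) ⊆ Tateʳ(X)`, Tate 1994 §1,
the trivial inclusion). [cite: Tate1994, §1] -/
theorem mem_tateClasses_of_mem_ratAlgebraicClasses (hX : IsSmoothProjective n X) {p : ℕ}
    {x : E.obj X (2 * p)} (hx : x ∈ E.ratAlgebraicClasses X p) : x ∈ E.tateClasses X p :=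
  algebraicClasses_le_tateClasses E hX p (E.ratAlgebraicClasses_le_algebraicClasses X p hx)

/-- Rational algebraic classes are Galois invariant in `H²ᵖ(X)(p)` (`cycleClass_ρ`, Tate 1994 §1,
the trivial inclusion of `Tᵖ(X/k)`). [cite: Tate1994, §1] -/
theorem mem_invariants_of_mem_ratAlgebraicClasses (hX : IsSmoothProjective n X) {p : ℕ}
    {x : E.obj X (2 * p)} (hx : x ∈ E.ratAlgebraicClasses X p) :
    x ∈ (E.ρTwist X (2 * p) p).invariants :=
  E.algebraicClasses_le_invariants hX p (E.ratAlgebraicClasses_le_algebraicClasses X p hx)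

/-! ## Dominated varieties: `Tateᵇ(U) = f₊ Tate^{b+r}(V)` -/

/-- **`Tateᵇ(U) = f₊ Tateᵃ(V)`, `a = b + r`, for `U` dominated by `V`** (`f : V ⟶ U`,
`dim V = dim U + r`, `f₊ ζ ≠ 0` for some `ζ ∈ Aʳ(V)_ℚ`, Kleiman 1968 Prop. 1.2.4): `⊇` is
`pushforward_mem_tateClasses`; for `⊆`, a Tate class `x` on `U` is `f₊ (q⁻¹ · (f* x ∪ ζ))`
(`f₊ ζ = q · 1`, projection formula, Kahn 2020 Lemma 6.30 (2)) and `f* x ∪ ζ` is a Tate class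
(`pullback_mem_tateClasses`, `cup_mem_tateClasses`, algebraic classes are Tate). Degrees:
`2a + c = 2N`, `2b + c = 2M`. [cite: Tate1994, §1] [cite: Kahn2020, §6.9 Lemma 6.30 (2)] -/
theorem map_pushforward_tateClasses_eq (hV : IsSmoothProjective N V) (hU : IsSmoothProjective M U)
    (f : V ⟶ U) {ζ : E.obj V (2 * r)} (hζ : ζ ∈ E.ratAlgebraicClasses V r)
    {he : 2 * r + 2 * M = 2 * N} {hd : 0 + 2 * M = 2 * M}
    (hne : E.pushforward (N := N) hU f he hd ζ ≠ 0) {b a c : ℕ} (ha : b + r = a)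
    (he' : 2 * a + c = 2 * N) (hd' : 2 * b + c = 2 * M) :
    (E.tateClasses V a).map (E.pushforward (N := N) hU f he' hd') = E.tateClasses U b := by
  refine le_antisymm ?_ fun x hx ↦ ?_
  · rintro _ ⟨y, hy, rfl⟩
    exact E.pushforward_mem_tateClasses hV hU f (by omega) he' hd' hy
  · obtain ⟨q, hq⟩ := E.exists_pushforward_eq_ratCast_smul_one hV hU f hζ he hd
    have hq0 : q ≠ 0 := by
      rintro rfl
      exact hne (by rw [hq, Rat.cast_zero, zero_smul])
    refine ⟨((q⁻¹ : ℚ) : K) • E.cup (by omega) (E.pullback f (2 * b) x) ζ,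
      Submodule.smul_mem _ _ (E.cup_mem_tateClasses hV ha _ (E.pullback_mem_tateClasses hV hU f hx)
        (E.mem_tateClasses_of_mem_ratAlgebraicClasses hV hζ)), ?_⟩
    exact (E.eq_pushforward_of_pushforward_eq_smul_one hV hU f hq hq0 (by omega) hd' he' x).symm

/-- **`(H²ᵇ(U)(b))^Γ = f₊ (H²ᵃ(V)(a))^Γ`, `a = b + r`, for `U` dominated by `V`** (same proof
with Galois invariants: `pullback_mem_invariants`, `cup_mem_invariants`, `cycleClass_ρ`).
[cite: Tate1994, §1] [cite: Kahn2020, §6.9 Lemma 6.30 (2)] -/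
theorem map_pushforward_invariants_eq (hV : IsSmoothProjective N V) (hU : IsSmoothProjective M U)
    (f : V ⟶ U) {ζ : E.obj V (2 * r)} (hζ : ζ ∈ E.ratAlgebraicClasses V r)
    {he : 2 * r + 2 * M = 2 * N} {hd : 0 + 2 * M = 2 * M}
    (hne : E.pushforward (N := N) hU f he hd ζ ≠ 0) {b a c : ℕ} (ha : b + r = a)
    (he' : 2 * a + c = 2 * N) (hd' : 2 * b + c = 2 * M) :
    (E.ρTwist V (2 * a) a).invariants.map (E.pushforward (N := N) hU f he' hd') =
      (E.ρTwist U (2 * b) b).invariants := by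
  refine le_antisymm ?_ fun x hx ↦ ?_
  · rintro _ ⟨y, hy, rfl⟩
    exact E.pushforward_mem_invariants hV hU f he' hd' (by omega) hy
  · obtain ⟨q, hq⟩ := E.exists_pushforward_eq_ratCast_smul_one hV hU f hζ he hd
    have hq0 : q ≠ 0 := by
      rintro rfl
      exact hne (by rw [hq, Rat.cast_zero, zero_smul])
    refine ⟨((q⁻¹ : ℚ) : K) • E.cup (by omega) (E.pullback f (2 * b) x) ζ,
      Submodule.smul_mem _ _ (E.cup_mem_invariants hV _ (by omega)
        (E.pullback_mem_invariants hV hU f hx) (E.mem_invariants_of_mem_ratAlgebraicClasses hV hζ)),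
      ?_⟩
    exact (E.eq_pushforward_of_pushforward_eq_smul_one hV hU f hq hq0 (by omega) hd' he' x).symm

/-- **`Tate ⊆ algebraic` descends to dominated varieties**: if every Tate class in `H²ᵃ(V)(a)` is
a `K`-linear combination of algebraic classes (`a = b + r`), then so is every Tate class in
`H²ᵇ(U)(b)` for `U` dominated by `V` — `Tateᵇ(U) = f₊ Tateᵃ(V)` and `f₊` preserves algebraic
classes (`pushforward_mem_algebraicClasses`, Kleiman 1968 §1.3). (The converse inclusion
`algebraic ⊆ Tate` always holds, `algebraicClasses_le_tateClasses`.)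
[cite: Tate1994, §1 (Conjecture Tᵖ over finite extensions)] [cite: Kleiman1968AlgebraicCycles, §1.3] -/
theorem tateClasses_le_algebraicClasses_of_pushforward_ne_zero (hV : IsSmoothProjective N V)
    (hU : IsSmoothProjective M U) (f : V ⟶ U) {ζ : E.obj V (2 * r)}
    (hζ : ζ ∈ E.ratAlgebraicClasses V r) {he : 2 * r + 2 * M = 2 * N} {hd : 0 + 2 * M = 2 * M}
    (hne : E.pushforward (N := N) hU f he hd ζ ≠ 0) {b a : ℕ} (ha : b + r = a)
    (hT : E.tateClasses V a ≤ E.algebraicClasses V a) :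
    E.tateClasses U b ≤ E.algebraicClasses U b := by
  intro x hx
  by_cases hb : b ≤ M
  · rw [← E.map_pushforward_tateClasses_eq hV hU f hζ hne ha (c := 2 * M - 2 * b) (by omega)
      (by omega)] at hx
    obtain ⟨y, hy, rfl⟩ := hx
    exact E.pushforward_mem_algebraicClasses hV hU f _ _ (hT hy)
  · haveI := E.subsingleton_obj hU (i := 2 * b) (by omega)
    rw [Subsingleton.elim x 0]
    exact zero_mem _

/-! ## Frobenius and push-forward over a finite field -/

section Frobenius

variable [Finite k]

/-- **`F (f₊ α) = χ(F)^{N-M} · f₊ (F α)`** for the geometric Frobenius `F = geomFrob k` acting on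
`Hᵉ(V)` and `Hᵈ(U)` (`frobAction`): push-forward commutes with Frobenius up to the twist
(`pushforward_ρ` at `g = F`; with `χ(F) = q⁻¹` the classical `F ∘ f₊ = q^{M-N} f₊ ∘ F`,
Deligne 1974 (1.5), Kahn 2020 §3.5.1). [cite: Deligne1974, (1.5)] [cite: Kahn2020, §3.5.1] -/
theorem frobAction_pushforward (hV : IsSmoothProjective N V) (hU : IsSmoothProjective M U)
    (f : V ⟶ U) {e d c : ℕ} (he : e + c = 2 * N) (hd : d + c = 2 * M) (α : E.obj V e) :
    E.frobAction U d (E.pushforward (N := N) hU f he hd α) =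
      ((χ (geomFrob k) : K) ^ ((N : ℤ) - M)) • E.pushforward (N := N) hU f he hd
        (E.frobAction V e α) := by
  have hχ : (χ (geomFrob k) : K) ≠ 0 := Units.ne_zero _
  rw [E.frobAction_def, E.frobAction_def, E.pushforward_ρ hV hU f he hd, smul_smul,
    ← zpow_add₀ hχ, show (N : ℤ) - M + (M - N) = 0 by ring, zpow_zero, one_smul]

/-- **`F ∘ f₊ = χ(F)^{N-M} · (f₊ ∘ F)`** as linear maps `Hᵉ(V) → Hᵈ(U)` (`frobAction_pushforward`).
[cite: Deligne1974, (1.5)] [cite: Kahn2020, §3.5.1] -/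
theorem frobAction_comp_pushforward (hV : IsSmoothProjective N V) (hU : IsSmoothProjective M U)
    (f : V ⟶ U) {e d c : ℕ} (he : e + c = 2 * N) (hd : d + c = 2 * M) :
    E.frobAction U d ∘ₗ E.pushforward (N := N) hU f he hd =
      ((χ (geomFrob k) : K) ^ ((N : ℤ) - M)) •
        (E.pushforward (N := N) hU f he hd ∘ₗ E.frobAction V e) :=
  LinearMap.ext fun α ↦ by
    rw [LinearMap.comp_apply, E.frobAction_pushforward hV hU f he hd α, LinearMap.smul_apply,
      LinearMap.comp_apply]

/-- **Frobenius eigenvalues transfer along `f₊`**: if `F α = λ α` on `Hᵉ(V)` then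
`F (f₊ α) = χ(F)^{N-M} λ · f₊ α` on `Hᵈ(U)` (for `U` dominated by `V` every class on `U` is such
an `f₊ α`, `pushforward_surjective_of_pushforward_ne_zero`). [cite: Deligne1974, (1.5)] -/
theorem frobAction_pushforward_of_eigenvector (hV : IsSmoothProjective N V)
    (hU : IsSmoothProjective M U) (f : V ⟶ U) {e d c : ℕ} (he : e + c = 2 * N)
    (hd : d + c = 2 * M) {α : E.obj V e} {μ : K} (hα : E.frobAction V e α = μ • α) :
    E.frobAction U d (E.pushforward (N := N) hU f he hd α) =
      (((χ (geomFrob k) : K) ^ ((N : ℤ) - M)) * μ) • E.pushforward (N := N) hU f he hd α := by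
  rw [E.frobAction_pushforward hV hU f he hd α, hα, map_smul, smul_smul]

end Frobenius

end GaloisWeilCohomology

end Literature.AlgebraicGeometry.Motives
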